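import Summits.Ventures.Crystal3D.Theorems.StickyWulffConstantNoReconstructionGainExactPrep
import Summits.Ventures.Crystal3D.Theorems.StickyWulffConstantNoReconstructionGainCellFluxIsolated
import Summits.Ventures.Crystal3D.Theorems.StickyWulffConstantGenericWallFloorSampleDeficitUpper
import Summits.Ventures.Crystal3D.Theses.StickyWulffConstant
import HarnessLib

/-!
# REPLICATION: the crux forces exact zero gain (line `replication-exactness`, stub `stub_replication`)

HONEST FRAMING. Part of the venture `Summits/Ventures/Crystal3D` (cell `crystal3d-full`), supports the
crux `NoReconstructionGain` (stmt-Ventures-19144, route `route-Ventures-StickyWulffConstant`), line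
`replication-exactness` (skeleton v2, lead wulff-p1 g17).  This file lands the registered stub

* `stub_replication : NoReconstructionGain → ExactZeroGain` — THE LICENCE: if some finite film `Q` on a
  rigid half-crystal face `H(ν,s)` gained (`D(Q) < X(H,Q)`), the crux would fail for EVERY `R, C`;
* `not_noReconstructionGain_of_criminal`, `noCriminal_of_noReconstructionGain` — hence ONE criminal (a
  finite object) refutes the crux, and the crux implies `NoCriminal` (both unconditional).

Proof.  By integrality the gain is `≥ 1` (`contactDeficiency_add_one_le_plugCount`).  Take the slack
`δ` of `Q` (`exists_film_slack`), a separation `m ≥ 2·diam + 2`, and `≥ c ρ'²` flat lattice translations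
`t ∈ T` of norm `≤ ρ'/2`, pairwise `≥ m` apart, with heights in one window of width `δ/2`
(`exists_flatTranslations`); a vertical lattice offset `t₀` (`exists_fcc_height_mem_Icc`) puts the common
cut `s' = s + ⟪t₀,ν⟫ + a + δ/2` in `[−R, −R + 2m + 6]`.  The packing is the clamped lattice slab
`L = Λ₀ ∩ {s' − R_th ≤ ⟪z,ν⟫ ≤ s'} ∩ Cyl(ρ')` (`R_th = R + 2m + 12`, so `L ⊇ P_{ρ'}(ν,R)`: the packing
may contain MORE lattice balls than the sample) together with the copies `Q + t₀ + t`, `t ∈ T`: each copy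
is a film on `H(ν, s + ⟪t₀ + t, ν⟫)` with the same plugs and deficiency (translation covariance), its
plugs lie in `L`, the extra sites of `L` above its own cut are `< δ` higher (slack), distinct copies are
`≥ m − 2·diam ≥ 2` apart.  Hence `D = D(L) + #T·D(Q) − cross ≤ D(L) − #T`, while
`D(L) ≤ 2φ(ν)πρ'² + C_L ρ'` (`affineSampleDeficit_upper` through an isometry `ν ↦ e₃`) and the crux gives
`D ≥ 2φ(ν)πρ'² − C ρ'`: so `c ρ'²/4 ≤ #T ≤ (C + C_L) ρ'`, false for `ρ'` large.

WHAT THIS IS NOT: EXACT₀ itself (`stub_noCriminal`) and the wrapped residual stay open; rung F-C1 not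
moved.
-/

noncomputable section

namespace Summit.Ventures.Crystal3D.Theorems

open Summit.Ventures.Crystal3D
open Literature.MathematicalPhysics.StatisticalMechanics (fccStacking barlowStacking barlowPos constHagg
  isHaggSeq_const le_dist_of_mem_barlowStacking_ideal contactDeficiency orderedContacts)
open scoped InnerProductSpace
open Finset

/-- **The clamped lattice slab through an isometry**: its deficiency is at most the two flat faces plus a
linear remainder (`affineSampleDeficit_upper` in `ν`-coordinates). -/
theorem latticeBody_deficit_le {ν : EuclideanSpace ℝ (Fin 3)} (hν : ‖ν‖ = 1) (Rth : ℝ) (hRth : 1 ≤ Rth) :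
    ∃ CL : ℝ, ∀ a b : ℝ, b - a = Rth → ∀ ρ : ℝ, Rth ≤ ρ →
      ∀ L : Finset (EuclideanSpace ℝ (Fin 3)),
        (∀ z, z ∈ L ↔ (z ∈ fccStacking 1 (Real.sqrt (2 / 3)) ∧ a ≤ ⟪z, ν⟫_ℝ ∧ ⟪z, ν⟫_ℝ ≤ b ∧
          ‖z‖ ^ 2 - ⟪z, ν⟫_ℝ ^ 2 ≤ ρ ^ 2)) →
        contactDeficiency L ≤
          2 * (Real.sqrt 2 / 4 * ∑ᶠ w ∈ {w ∈ fccStacking 1 (Real.sqrt (2 / 3)) | ‖w‖ = 1},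
            |⟪w, ν⟫_ℝ|) * Real.pi * ρ ^ 2 + CL * ρ := by
  classical
  obtain ⟨g, hg⟩ := exists_linearIsometryEquiv_apply_eq_single_two ν hν
  have hgs : g.symm (EuclideanSpace.single (2 : Fin 3) (1 : ℝ)) = ν := by
    rw [← hg, LinearIsometryEquiv.symm_apply_apply]
  obtain ⟨CL, hCL⟩ := affineSampleDeficit_upper g 0 Rth hRth
  refine ⟨CL, fun a b hab ρ hρ L hL => ?_⟩
  have h := hCL a b hab ρ hρ (L.image g) ?_
  · rw [contactDeficiency_image_of_isometry g.isometry, hgs] at h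
    exact h
  · intro p
    rw [Finset.mem_image]
    have hp2 : ∀ z : EuclideanSpace ℝ (Fin 3), g z 2 = ⟪z, ν⟫_ℝ := by
      intro z
      have : g z 2 = ⟪g z, EuclideanSpace.single (2 : Fin 3) (1 : ℝ)⟫_ℝ := by
        rw [EuclideanSpace.inner_single_right]; simp
      rw [this, ← hg, LinearIsometryEquiv.inner_map_map]
    have hp01 : ∀ z : EuclideanSpace ℝ (Fin 3), g z 0 ^ 2 + g z 1 ^ 2 = ‖z‖ ^ 2 - ⟪z, ν⟫_ℝ ^ 2 := by
      intro z
      rw [sq_add_sq_eq_norm_sq_sub, ← hp2 z, LinearIsometryEquiv.norm_map]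
      congr 1
      rw [EuclideanSpace.inner_single_right]; simp
    constructor
    · rintro ⟨z, hz, rfl⟩
      obtain ⟨hzΛ, h1, h2, h3⟩ := (hL z).1 hz
      refine ⟨⟨z, hzΛ, by simp⟩, ?_, ?_, ?_⟩
      · rw [hp2]; exact h1
      · rw [hp2]; exact h2
      · rw [hp01]; exact h3
    · rintro ⟨⟨z, hzΛ, hzp⟩, h1, h2, h3⟩
      simp only [add_zero] at hzp
      subst hzp
      rw [hp2] at h1 h2
      rw [hp01] at h3
      exact ⟨z, (hL z).2 ⟨hzΛ, h1, h2, h3⟩, rfl⟩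

set_option maxHeartbeats 400000 in
/-- **STUB `stub_replication` of the line `replication-exactness`: the crux forces exact zero gain on
every rigid half-crystal face** (REPLICATION of a gaining film by flat lattice translations). -/
theorem stub_replication :
    Summit.Ventures.Crystal3D.Theses.StickyWulffConstant.NoReconstructionGain → ExactZeroGain := by
  classical
  intro hNRG ν hν s Q hQ
  by_contra hgain
  push Not at hgain
  unfold Summit.Ventures.Crystal3D.Theses.StickyWulffConstant.NoReconstructionGain at hNRG
  obtain ⟨R, C, hR, hmain⟩ := hNRG
  -- (1) film constants
  have hint := contactDeficiency_add_one_le_plugCount hgain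
  obtain ⟨δ, hδ, hδ1, hslack⟩ := exists_film_slack ν s Q
  set Dq : ℝ := ∑ q ∈ Q, ‖q‖ with hDq
  have hDq0 : 0 ≤ Dq := Finset.sum_nonneg fun q _ => norm_nonneg q
  have hqDq : ∀ q ∈ Q, ‖q‖ ≤ Dq := fun q hq =>
    Finset.single_le_sum (f := fun q => ‖q‖) (fun q _ => norm_nonneg q) hq
  obtain ⟨m, hm⟩ : ∃ m : ℕ, m = ⌈2 * Dq + 2⌉₊ + 1 := ⟨_, rfl⟩
  have hm1 : 1 ≤ m := by rw [hm]; exact Nat.le_add_left 1 _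
  have hmR : 2 * Dq + 2 ≤ (m : ℝ) := by
    rw [hm]; push_cast; linarith [Nat.le_ceil (2 * Dq + 2)]
  have hm0 : (0 : ℝ) ≤ m := Nat.cast_nonneg m
  -- (2) flat translations
  obtain ⟨c, hc, ρ₀, hρ₀, hflat⟩ :=
    exists_flatTranslations ν hν (δ / 2) (by linarith) (by linarith) m hm1
  -- (3) vertical offset
  obtain ⟨t₀, ht₀Λ, ht₀lo, ht₀hi⟩ := exists_fcc_height_mem_Icc hν (-R + m + 2 - s)
  -- (4) the sample-deficit constant
  set Rth : ℝ := R + 2 * m + 12 with hRth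
  have hRth1 : 1 ≤ Rth := by rw [hRth]; linarith
  obtain ⟨CL, hCL⟩ := latticeBody_deficit_le hν Rth hRth1
  -- (5) the radius
  set ρ' : ℝ := max (max R (2 * ρ₀)) (max Rth (max (2 * (Dq + ‖t₀‖ + 2))
    (4 * (|C| + |CL|) / c + 1))) with hρ'
  have hρ'R : R ≤ ρ' := le_max_of_le_left (le_max_left _ _)
  have hρ'ρ₀ : ρ₀ ≤ ρ' / 2 := by
    have : 2 * ρ₀ ≤ ρ' := le_max_of_le_left (le_max_right _ _); linarith
  have hρ'Rth : Rth ≤ ρ' := le_max_of_le_right (le_max_left _ _)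
  have hρ'lat : Dq + ‖t₀‖ + 2 ≤ ρ' / 2 := by
    have : 2 * (Dq + ‖t₀‖ + 2) ≤ ρ' := le_max_of_le_right (le_max_of_le_right (le_max_left _ _))
    linarith
  have hρ'c : 4 * (|C| + |CL|) / c + 1 ≤ ρ' :=
    le_max_of_le_right (le_max_of_le_right (le_max_right _ _))
  have hρ'pos : 0 < ρ' := lt_of_lt_of_le hR hρ'R
  obtain ⟨T, hTΛ, hTnorm, hTsep, ⟨a, ha, hwin⟩, hTcard⟩ := hflat (ρ' / 2) hρ'ρ₀
  -- (6) the cut and the lattice body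
  set s' : ℝ := s + ⟪t₀, ν⟫_ℝ + a + δ / 2 with hs'
  rw [abs_le] at ha
  have hs'lo : -R ≤ s' := by rw [hs']; linarith
  have hs'hi : s' ≤ -R + 2 * m + 6 := by rw [hs']; linarith
  obtain ⟨L, hL⟩ := exists_latticeBody ν (s' - Rth) s' ρ'
  -- (7) the copies
  set G : EuclideanSpace ℝ (Fin 3) → Finset (EuclideanSpace ℝ (Fin 3)) :=
    fun t => Q.image fun q => q + (t₀ + t) with hG
  set F := T.biUnion G with hF
  have hτΛ : ∀ t ∈ T, t₀ + t ∈ fccStacking 1 (Real.sqrt (2 / 3)) :=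
    fun t ht => fcc_add_site_mem ht₀Λ (hTΛ t ht)
  have hcut : ∀ t ∈ T, s' - δ / 2 ≤ s + ⟪t₀ + t, ν⟫_ℝ ∧ s + ⟪t₀ + t, ν⟫_ℝ < s' := by
    intro t ht
    obtain ⟨hw1, hw2⟩ := hwin t ht
    rw [inner_add_left, hs']
    constructor <;> linarith
  have hfilm : ∀ t ∈ T, IsFilmOn ν (s + ⟪t₀ + t, ν⟫_ℝ) (G t) :=
    fun t ht => isFilmOn_translate (hτΛ t ht) hQ
  have hpc : ∀ t ∈ T, plugCount ν (s + ⟪t₀ + t, ν⟫_ℝ) (G t) = plugCount ν s Q :=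
    fun t ht => plugCount_translate (hτΛ t ht) s Q
  have hDG : ∀ t, contactDeficiency (G t) = contactDeficiency Q :=
    fun t => contactDeficiency_translate _ Q
  have hGmem : ∀ t y, y ∈ G t ↔ ∃ q ∈ Q, y = q + (t₀ + t) := by
    intro t y
    rw [hG, Finset.mem_image]
    constructor
    · rintro ⟨q, hq, rfl⟩; exact ⟨q, hq, rfl⟩
    · rintro ⟨q, hq, rfl⟩; exact ⟨q, hq, rfl⟩
  have hGnorm : ∀ t ∈ T, ∀ y ∈ G t, ‖y‖ ≤ Dq + ‖t₀‖ + ρ' / 2 := by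
    intro t ht y hy
    obtain ⟨q, hq, rfl⟩ := (hGmem t y).1 hy
    calc ‖q + (t₀ + t)‖ ≤ ‖q‖ + ‖t₀ + t‖ := norm_add_le _ _
      _ ≤ ‖q‖ + (‖t₀‖ + ‖t‖) := add_le_add le_rfl (norm_add_le _ _)
      _ ≤ Dq + (‖t₀‖ + ρ' / 2) := add_le_add (hqDq q hq) (add_le_add le_rfl (hTnorm t ht))
      _ = Dq + ‖t₀‖ + ρ' / 2 := by ring
  have hGheight : ∀ t ∈ T, ∀ y ∈ G t, s' - δ / 2 - 3 / 4 < ⟪y, ν⟫_ℝ := by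
    intro t ht y hy
    have h1 := film_height_gt hν (hfilm t ht) hy
    linarith [(hcut t ht).1]
  -- (8) distances
  have hfarGG : ∀ t ∈ T, ∀ t' ∈ T, t ≠ t' → ∀ y ∈ G t, ∀ y' ∈ G t', 1 < dist y y' := by
    intro t ht t' ht' hne y hy y' hy'
    obtain ⟨q, hq, rfl⟩ := (hGmem t y).1 hy
    obtain ⟨q', hq', rfl⟩ := (hGmem t' y').1 hy'
    have hsep := hTsep t ht t' ht' hne
    rw [dist_eq_norm] at hsep ⊢
    have e : q + (t₀ + t) - (q' + (t₀ + t')) = (t - t') + (q - q') := by abel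
    rw [e]
    have h1 : ‖t - t'‖ - ‖q - q'‖ ≤ ‖(t - t') + (q - q')‖ := by
      have h3 := norm_sub_norm_le (t - t') (-(q - q'))
      rwa [norm_neg, sub_neg_eq_add] at h3
    have h2 : ‖q - q'‖ ≤ 2 * Dq := by
      calc ‖q - q'‖ ≤ ‖q‖ + ‖q'‖ := norm_sub_le _ _
        _ ≤ Dq + Dq := add_le_add (hqDq q hq) (hqDq q' hq')
        _ = 2 * Dq := by ring
    linarith
  have hdisjGG : ∀ t ∈ T, ∀ t' ∈ T, t ≠ t' → Disjoint (G t) (G t') := by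
    intro t ht t' ht' hne
    rw [Finset.disjoint_left]
    intro y hy hy'
    have := hfarGG t ht t' ht' hne y hy y hy'
    rw [dist_self] at this; linarith
  have hLG : ∀ z ∈ L, ∀ t ∈ T, ∀ y ∈ G t, 1 ≤ dist z y := by
    intro z hz t ht y hy
    obtain ⟨hzΛ, -, hzhi, -⟩ := (hL z).1 hz
    by_cases hzc : ⟪z, ν⟫_ℝ ≤ s + ⟪t₀ + t, ν⟫_ℝ
    · rw [dist_comm]; exact (hfilm t ht).2 y hy z ⟨hzΛ, hzc⟩
    · push Not at hzc
      obtain ⟨q, hq, rfl⟩ := (hGmem t y).1 hy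
      have hz' : z - (t₀ + t) ∈ fccStacking 1 (Real.sqrt (2 / 3)) := fcc_sub_site_mem hzΛ (hτΛ t ht)
      have h1 : s < ⟪z - (t₀ + t), ν⟫_ℝ := by rw [inner_sub_left]; linarith
      have h2 : ⟪z - (t₀ + t), ν⟫_ℝ ≤ s + δ := by
        rw [inner_sub_left]; linarith [(hcut t ht).1]
      have h3 := hslack _ hz' h1 h2 q hq
      have e : dist (q + (t₀ + t)) z = dist q (z - (t₀ + t)) := by
        rw [dist_eq_norm, dist_eq_norm]; congr 1; abel
      rw [dist_comm, e]; exact h3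
  have hLL : ∀ z ∈ L, ∀ z' ∈ L, z ≠ z' → 1 ≤ dist z z' := fun z hz z' hz' hne =>
    le_dist_of_mem_barlowStacking_ideal isHaggSeq_const one_pos fcc_height_sq ((hL z).1 hz).1
      ((hL z').1 hz').1 hne
  have hFmem : ∀ y, y ∈ F ↔ ∃ t ∈ T, y ∈ G t := by
    intro y; rw [hF, Finset.mem_biUnion]
  -- the packing is a packing
  set X := L ∪ F with hX
  have hXpack : ∀ p ∈ X, ∀ q ∈ X, p ≠ q → 1 ≤ dist p q := by
    intro p hp q hq hne
    rw [hX, Finset.mem_union] at hp hq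
    rcases hp with hp | hp <;> rcases hq with hq | hq
    · exact hLL p hp q hq hne
    · obtain ⟨t, ht, hqt⟩ := (hFmem q).1 hq
      exact hLG p hp t ht q hqt
    · obtain ⟨t, ht, hpt⟩ := (hFmem p).1 hp
      rw [dist_comm]; exact hLG q hq t ht p hpt
    · obtain ⟨t, ht, hpt⟩ := (hFmem p).1 hp
      obtain ⟨t', ht', hqt⟩ := (hFmem q).1 hq
      by_cases htt : t = t'
      · subst htt
        exact (hfilm t ht).1 p hpt q hqt hne
      · exact (hfarGG t ht t' ht' htt p hpt q hqt).le
  have hLFdisj : Disjoint L F := by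
    rw [Finset.disjoint_left]
    intro z hz hzF
    obtain ⟨t, ht, hzt⟩ := (hFmem z).1 hzF
    have := hLG z hz t ht z hzt
    rw [dist_self] at this; linarith
  -- (9) enumerate and apply the crux
  obtain ⟨N, x, hxpack, hxsurj, hxD⟩ := exists_unitPacking_of_finset X hXpack
  have hsample : ∀ p ∈ fccStacking 1 (Real.sqrt (2 / 3)), -(2 * R) ≤ ⟪p, ν⟫_ℝ → ⟪p, ν⟫_ℝ ≤ -R →
      ‖p‖ ^ 2 - ⟪p, ν⟫_ℝ ^ 2 ≤ ρ' ^ 2 → ∃ i, x i = p := by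
    intro p hp h1 h2 h3
    refine hxsurj p ?_
    rw [hX, Finset.mem_union]
    left
    exact (hL p).2 ⟨hp, by rw [hRth]; linarith, by linarith, h3⟩
  have hN := hmain ν hν ρ' hρ'R N x hxpack hsample
  rw [hxD] at hN
  -- (10) the deficiency of the packing
  have hDX : contactDeficiency X = contactDeficiency L + contactDeficiency F -
      ((((L ×ˢ F).filter fun pq => dist pq.1 pq.2 = 1).card : ℕ) : ℝ) := by
    have h := contactDeficiency_sdiff_split (X := X) (P := L) (by rw [hX]; exact Finset.subset_union_left)
    rw [show X \ L = F by rw [hX, Finset.union_sdiff_cancel_left hLFdisj]] at h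
    exact h
  have hDF : contactDeficiency F = T.card * contactDeficiency Q := by
    rw [hF, contactDeficiency_biUnion_of_far T G hfarGG]
    simp only [hDG, Finset.sum_const, nsmul_eq_mul]
  have hcross : (T.card : ℝ) * plugCount ν s Q ≤
      ((((L ×ˢ F).filter fun pq => dist pq.1 pq.2 = 1).card : ℕ) : ℝ) := by
    rw [hF, card_cross_biUnion L T G hdisjGG]
    push_cast
    have : ∀ t ∈ T, (plugCount ν s Q : ℝ) ≤ ((((L ×ˢ G t).filter fun pq => dist pq.1 pq.2 = 1).card : ℕ) : ℝ) := by
      intro t ht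
      rw [← hpc t ht, card_cross_eq_sum, plugCount]
      push_cast
      refine Finset.sum_le_sum fun y hy => ?_
      -- every plug site of the copy lies in the body
      have hsub : ∀ z ∈ plugSet ν (s + ⟪t₀ + t, ν⟫_ℝ) y, z ∈ L := by
        intro z hz
        obtain ⟨⟨hzΛ, hzc⟩, hzd⟩ := hz
        have hyh := hGheight t ht y hy
        have hyn := hGnorm t ht y hy
        have hzh : ⟪y, ν⟫_ℝ - 1 ≤ ⟪z, ν⟫_ℝ := by
          have := (le_abs_self _).trans (abs_inner_sub_le_dist hν y z)
          rw [hzd] at this; linarith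
        refine (hL z).2 ⟨hzΛ, ?_, by linarith [(hcut t ht).2], ?_⟩
        · rw [hRth]; linarith
        · have hz1 : ‖z‖ ≤ ‖y‖ + 1 := by
            have := norm_sub_norm_le z y
            rw [← dist_eq_norm, dist_comm, hzd] at this; linarith
          have hz2 : ‖z‖ ≤ ρ' := by linarith
          nlinarith [norm_nonneg z, sq_nonneg ⟪z, ν⟫_ℝ]
      exact_mod_cast plugSet_ncard_le_card_filter ν _ L y hsub
    calc (T.card : ℝ) * plugCount ν s Q = ∑ t ∈ T, (plugCount ν s Q : ℝ) := by
          rw [Finset.sum_const, nsmul_eq_mul]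
      _ ≤ _ := Finset.sum_le_sum this
  -- (11) the body's deficiency
  have hDL := hCL (s' - Rth) s' (by ring) ρ' hρ'Rth L hL
  -- (12) counting: `c ρ'²/4 ≤ #T ≤ (C + C_L) ρ'`
  have hM : c * (ρ' / 2) ^ 2 ≤ T.card := hTcard
  have hprod : (T.card : ℝ) * (contactDeficiency Q + 1) ≤ (T.card : ℝ) * plugCount ν s Q :=
    mul_le_mul_of_nonneg_left hint (Nat.cast_nonneg _)
  have hDXle : contactDeficiency X ≤ contactDeficiency L - T.card := by
    rw [hDX, hDF]; linarith
  have h1 : (T.card : ℝ) ≤ (C + CL) * ρ' := by linarith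
  have h2 : (C + CL) * ρ' ≤ (|C| + |CL|) * ρ' :=
    mul_le_mul_of_nonneg_right (add_le_add (le_abs_self C) (le_abs_self CL)) hρ'pos.le
  have h3 : c * ρ' / 4 ≤ |C| + |CL| := by
    have : c * (ρ' / 2) ^ 2 = (c * ρ' / 4) * ρ' := by ring
    rw [this] at hM
    exact le_of_mul_le_mul_right (hM.trans (h1.trans h2)) hρ'pos
  have h4 : ρ' ≤ 4 * (|C| + |CL|) / c := by
    rw [le_div_iff₀ hc]
    calc ρ' * c = 4 * (c * ρ' / 4) := by ring
      _ ≤ 4 * (|C| + |CL|) := mul_le_mul_of_nonneg_left h3 (by norm_num)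
  exact not_le.2 (lt_add_one (4 * (|C| + |CL|) / c)) (hρ'c.trans h4)

/-- **One criminal refutes the crux for every `R`, `C`** (`CriminalRefutes` of the folded idea card, all
normals): a nonempty film on a rigid half-crystal face all of whose nonempty sub-blocks are strictly
over-attached contradicts `NoReconstructionGain`. -/
theorem not_noReconstructionGain_of_criminal {ν : EuclideanSpace ℝ (Fin 3)} (hν : ‖ν‖ = 1) {s : ℝ}
    {Q : Finset (EuclideanSpace ℝ (Fin 3))} (hQ : IsCriminal ν s Q) :
    ¬ Summit.Ventures.Crystal3D.Theses.StickyWulffConstant.NoReconstructionGain := by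
  classical
  intro h
  obtain ⟨hfilm, hne, hcore⟩ := hQ
  have h1 := hcore Q (Finset.Subset.refl Q) hne
  have h2 := stub_replication h ν hν s Q hfilm
  simp only [Finset.sdiff_self, Finset.empty_product, Finset.filter_empty, Finset.card_empty,
    Nat.cast_zero, add_zero] at h1
  linarith

/-- **The crux implies that no criminal exists** (`NoReconstructionGain → NoCriminal`, unconditional). -/
theorem noCriminal_of_noReconstructionGain
    (h : Summit.Ventures.Crystal3D.Theses.StickyWulffConstant.NoReconstructionGain) : NoCriminal :=
  fun _ hν _ _ hQ => not_noReconstructionGain_of_criminal hν hQ h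

end Summit.Ventures.Crystal3D.Theorems

end
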